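import Literature.NumberTheory.Sieve.LargestPrimeFactorCubicProofs
import HarnessLib

/-!
# Irving 2015, §3: the divisor set `𝒟` of Lemma 3.1 and the bound `T(h,δ) ≤ ∑_{d ∈ 𝒟} A_d`

Fourth proved layer under the named fact `Irving2015_largestPrimeFactor_cubic`
(`LargestPrimeFactorCubic.lean`; A. J. Irving, arXiv:1412.0024 = Acta Arith. 171 (2015)), towards
his Lemma 3.2 (`T(h,δ) ≤ X(c(h,δ) + o(1))`, the first estimate for the number `T(h,δ)` of
`n ∈ (X, 2X]` such that `n³ + 2` has at least `h` prime factors `≥ X^δ` counted with multiplicity).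
Everything here is elementary and PROVED (the combinatorial heart of
"`∑_{d∈𝒟, μ(d)≠0} ν(d)/d ≤ (1/k!)(log …)^k`", the bound `e_k(a) ≤ (∑ a)^k/k!` on elementary
symmetric sums, is already in the tree: `CubicSieve.esymm_le_pow_div_factorial`,
`HeathBrownCubicChainSums.lean`, and is used in the next file):

* `Irving2015.exists_dvd_of_le_card_largePrimeFactors'` — Lemma 3.1 in full: if `Ω_z(m) ≥ h ≥ 3`
  then `m` has a divisor `d = p₁⋯p_k`, `k = [h/3]`, `d³ ≤ m`, with all prime factors `p ≥ z` and
  `z^{k-1} p^{h-k+1} ≤ m` (the printed constraint `p₁⋯p_{k-1}p_k^{h-k+1} ≤ 9X³`, which bounds the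
  largest prime factor: `pow_mul_pow_le_prod_of_mem_take`), refining
  `exists_dvd_of_le_card_largePrimeFactors` of `LargestPrimeFactorCubicProofs.lean`;
* `Irving2015.card_largeOmega_le_sum_divisorSet` — hence
  `T(h) ≤ ∑_{d ∈ 𝒟} #{n ∈ (X,2X] : d ∣ n³+2}` with the explicit finite set
  `𝒟 = {1 ≤ d ≤ 3X : Ω(d) = k, ∀ p ∣ d prime: z ≤ p, z^{k-1}p^{h-k+1} ≤ 10X³}` (union bound
  `card_filter_exists_le_sum`).

The analytic evaluation of `∑_{d∈𝒟} ν(d)(X/d + 1)` (Mertens for `ν` on `[X^δ, Z]`, the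
non-squarefree `d`, `#𝒟 ≪ X/log X`) is the next file.

## References

* A. J. Irving, *The largest prime factor of `X³ + 2`*, arXiv:1412.0024; Acta Arith. 171 (2015)
  67–80, §3, Lemma 3.1 and the two displays after it. [`Irving2014LargestPrimeFactorCubic`]
-/

noncomputable section

open Finset

namespace Literature.NumberTheory.Sieve

namespace Irving2015

/-! ### Irving's Lemma 3.1, with the constraint on the largest prime factor -/

/-- In a sorted list of integers `≥ z ≥ 1` of length `≥ h`, every one of the first `k` entries `p`
(`1 ≤ k ≤ h`) satisfies `z^{k-1} p^{h-k+1} ≤ ∏ l` (compare `z` with the first `k − 1` entries and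
`p` with the next `h − k + 1`).  Irving: "`p₁ ⋯ p_{k-1} p_k^{h-k+1} ≤ p₁ p₂ ⋯ p_h`".
[cite: Irving2014LargestPrimeFactorCubic, Lemma 3.1 (proof)] -/
theorem pow_mul_pow_le_prod_of_mem_take {l : List ℕ} (hl : l.Pairwise (· ≤ ·)) {z : ℕ} (hz1 : 1 ≤ z)
    (hz : ∀ x ∈ l, z ≤ x) {k h : ℕ} (hk : 1 ≤ k) (hkh : k ≤ h) (hh : h ≤ l.length) {p : ℕ}
    (hp : p ∈ l.take k) : z ^ (k - 1) * p ^ (h - k + 1) ≤ l.prod := by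
  set A := l.take (k - 1) with hA
  set R := l.drop (k - 1) with hR
  have hAR : A ++ R = l := List.take_append_drop _ _
  have h1 : ∀ x ∈ l, 1 ≤ x := fun x hx => hz1.trans (hz x hx)
  have hl' := hl
  rw [← hAR, List.pairwise_append] at hl'
  have hlenA : A.length = k - 1 := by rw [hA, List.length_take]; omega
  have hlenR : R.length = l.length - (k - 1) := by rw [hR, List.length_drop]
  -- `p ≤ r` for every `r ∈ R`
  have hpR : ∀ r ∈ R, p ≤ r := by
    have htk : l.take k = A ++ R.take 1 := by
      rw [hA, hR, show k = (k - 1) + 1 from by omega, List.take_add]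
      congr 1
    rw [htk, List.mem_append] at hp
    rcases hp with hpA | hp1
    · exact fun r hr => hl'.2.2 p hpA r hr
    · intro r hr
      obtain ⟨q, R', hqR⟩ : ∃ q R', R = q :: R' := by
        cases hRc : R with
        | nil => rw [hRc] at hp1; simp at hp1
        | cons q R' => exact ⟨q, R', rfl⟩
      rw [hqR] at hp1 hr hl'
      have hpq : p = q := by simpa using hp1
      subst hpq
      rcases List.mem_cons.1 hr with rfl | hr'
      · exact le_rfl
      · exact List.rel_of_pairwise_cons hl'.2.1 hr'
  -- `z^{k-1} ≤ ∏ A`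
  have hzA : z ^ (k - 1) ≤ A.prod := by
    have hsf := sublistForall₂_of_forall_mem_le (A := List.replicate (k - 1) z) (S := A)
      (by rw [List.length_replicate, hlenA])
      (fun a ha b hb => by
        rw [List.eq_of_mem_replicate ha]
        exact hz b (by rw [← hAR]; exact List.mem_append_left _ hb))
    have := hsf.prod_le_prod' (fun b hb => h1 b (by rw [← hAR]; exact List.mem_append_left _ hb))
    simpa using this
  -- `p^{h-k+1} ≤ ∏ (R.take (h-k+1))`
  have hpRt : p ^ (h - k + 1) ≤ (R.take (h - k + 1)).prod := by
    have hsf := sublistForall₂_of_forall_mem_le (A := List.replicate (h - k + 1) p)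
      (S := R.take (h - k + 1))
      (by rw [List.length_replicate, List.length_take, hlenR]; omega)
      (fun a ha b hb => by
        rw [List.eq_of_mem_replicate ha]
        exact hpR b (List.mem_of_mem_take hb))
    have := hsf.prod_le_prod' (fun b hb => h1 b (by
      rw [← hAR]; exact List.mem_append_right _ (List.mem_of_mem_take hb)))
    simpa using this
  have hRt : (R.take (h - k + 1)).prod ≤ R.prod :=
    (List.take_sublist _ _).prod_le_prod' (fun b hb => h1 b (by
      rw [← hAR]; exact List.mem_append_right _ hb))
  calc z ^ (k - 1) * p ^ (h - k + 1) ≤ A.prod * (R.take (h - k + 1)).prod :=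
        Nat.mul_le_mul hzA hpRt
    _ ≤ A.prod * R.prod := Nat.mul_le_mul_left _ hRt
    _ = l.prod := by rw [← List.prod_append, hAR]

/-- **Irving 2015, Lemma 3.1** (full form): if `m ≠ 0` has at least `h ≥ 3` prime factors `≥ z`
(`z ≥ 1`) counted with multiplicity, then `m` has a divisor `d` with `Ω(d) = k := [h/3]`, `d³ ≤ m`,
all of whose prime factors `p` satisfy `z ≤ p` and `z^{k-1} p^{h-k+1} ≤ m` (Irving: `d = p₁ ⋯ p_k`
with `X^δ ≤ p₁ ≤ … ≤ p_k` and `p₁ ⋯ p_{k-1} p_k^{h-k+1} ≤ 9X³`).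
[cite: Irving2014LargestPrimeFactorCubic, Lemma 3.1] -/
theorem exists_dvd_of_le_card_largePrimeFactors' {m z h : ℕ} (hm : m ≠ 0) (hz1 : 1 ≤ z)
    (hh3 : 3 ≤ h) (hh : h ≤ ((Nat.primeFactorsList m).filter (fun p => z ≤ p)).length) :
    ∃ d : ℕ, d ∣ m ∧ d ^ 3 ≤ m ∧ ArithmeticFunction.cardFactors d = h / 3 ∧
      ∀ p : ℕ, p.Prime → p ∣ d → z ≤ p ∧ z ^ (h / 3 - 1) * p ^ (h - h / 3 + 1) ≤ m := by
  set L := (Nat.primeFactorsList m).filter (fun p => z ≤ p) with hL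
  set k := h / 3 with hk
  have hsubL : L.Sublist (Nat.primeFactorsList m) := List.filter_sublist
  have hprimeL : ∀ p ∈ L, p.Prime := fun p hp => Nat.prime_of_mem_primeFactorsList (hsubL.subset hp)
  have hsorted : L.Pairwise (· ≤ ·) := (Nat.primeFactorsList_sorted m).pairwise.sublist hsubL
  have h1 : ∀ p ∈ L, 1 ≤ p := fun p hp => (hprimeL p hp).one_lt.le
  have hzL : ∀ p ∈ L, z ≤ p := fun p hp => by simpa using (List.mem_filter.1 hp).2
  have hkL : 3 * k ≤ L.length := by omega
  have hprimek : ∀ p ∈ L.take k, p.Prime := fun p hp => hprimeL p (List.mem_of_mem_take hp)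
  have hLm : L.prod ≤ m := by
    calc L.prod ≤ (Nat.primeFactorsList m).prod :=
          hsubL.prod_le_prod' (fun p hp => (Nat.prime_of_mem_primeFactorsList hp).one_lt.le)
      _ = m := Nat.prod_primeFactorsList hm
  refine ⟨(L.take k).prod, ?_, ?_, ?_, ?_⟩
  · calc (L.take k).prod ∣ (Nat.primeFactorsList m).prod :=
          ((List.take_sublist k L).trans hsubL).prod_dvd_prod
      _ = m := Nat.prod_primeFactorsList hm
  · exact (prod_take_pow_three_le_prod hsorted h1 hkL).trans hLm
  · have hperm := Nat.primeFactorsList_unique (n := (L.take k).prod) rfl hprimek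
    rw [ArithmeticFunction.cardFactors_apply, ← hperm.length_eq, List.length_take]
    omega
  · intro p hp hpd
    obtain ⟨q, hq, hpq⟩ := (Prime.dvd_prod_iff hp.prime).1 hpd
    obtain rfl : p = q := (Nat.prime_dvd_prime_iff_eq hp (hprimek q hq)).1 hpq
    refine ⟨hzL p (List.mem_of_mem_take hq), ?_⟩
    have hkh : k ≤ h := by omega
    have := pow_mul_pow_le_prod_of_mem_take hsorted hz1 hzL (by omega : 1 ≤ k) hkh hh hq
    exact this.trans hLm

/-! ### Covering `T(h)` by the divisor set -/

/-- Union bound: `#{n ∈ S : ∃ d ∈ D, P d n} ≤ ∑_{d ∈ D} #{n ∈ S : P d n}`. [folklore] -/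
theorem card_filter_exists_le_sum {α β : Type*} [DecidableEq α] (S : Finset α) (D : Finset β)
    (P : β → α → Prop) [∀ d n, Decidable (P d n)] :
    #(S.filter fun n => ∃ d ∈ D, P d n) ≤ ∑ d ∈ D, #(S.filter fun n => P d n) := by
  calc #(S.filter fun n => ∃ d ∈ D, P d n) ≤ #(D.biUnion fun d => S.filter fun n => P d n) := by
        refine card_le_card (fun n hn => ?_)
        rw [mem_filter] at hn
        rw [mem_biUnion]
        obtain ⟨d, hd, hP⟩ := hn.2
        exact ⟨d, hd, mem_filter.2 ⟨hn.1, hP⟩⟩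
    _ ≤ ∑ d ∈ D, #(S.filter fun n => P d n) := card_biUnion_le

/-- **Irving 2015, §3** (the first property of `𝒟` turned into the bound `T(h,δ) ≤ ∑_{d∈𝒟} A_d`):
with `Ω_z(m)` the number of prime factors `≥ z` of `m` counted with multiplicity, `h ≥ 3`,
`k = [h/3]`, `z ≥ 1`, the number of `n ∈ (X, 2X]` with `Ω_z(n³+2) ≥ h` is at most
`∑_{d ∈ 𝒟} #{n ∈ (X,2X] : d ∣ n³+2}` where
`𝒟 = {1 ≤ d ≤ 3X : Ω(d) = k, every prime factor p of d has z ≤ p and z^{k-1} p^{h-k+1} ≤ 10X³}`.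
[cite: Irving2014LargestPrimeFactorCubic, §3 (p. 5) and Lemma 3.1] -/
theorem card_largeOmega_le_sum_divisorSet (X z h : ℕ) (hz1 : 1 ≤ z) (hh3 : 3 ≤ h) :
    #((Ioc X (2 * X)).filter fun n : ℕ =>
        h ≤ ((Nat.primeFactorsList (n ^ 3 + 2)).filter (fun p => z ≤ p)).length) ≤
      ∑ d ∈ (Icc 1 (3 * X)).filter (fun d : ℕ => ArithmeticFunction.cardFactors d = h / 3 ∧
          ∀ p ∈ d.primeFactors, z ≤ p ∧ z ^ (h / 3 - 1) * p ^ (h - h / 3 + 1) ≤ 10 * X ^ 3),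
        #((Ioc X (2 * X)).filter fun n : ℕ => d ∣ n ^ 3 + 2) := by
  classical
  set D := (Icc 1 (3 * X)).filter (fun d : ℕ => ArithmeticFunction.cardFactors d = h / 3 ∧
    ∀ p ∈ d.primeFactors, z ≤ p ∧ z ^ (h / 3 - 1) * p ^ (h - h / 3 + 1) ≤ 10 * X ^ 3) with hD
  refine le_trans (card_le_card ?_) (card_filter_exists_le_sum (Ioc X (2 * X)) D (fun d n => d ∣ n ^ 3 + 2))
  intro n hn
  rw [mem_filter] at hn ⊢
  refine ⟨hn.1, ?_⟩
  have hnX := mem_Ioc.1 hn.1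
  have hX : 1 ≤ X := by omega
  have hm10 : n ^ 3 + 2 ≤ 10 * X ^ 3 := by
    have h2 := Nat.pow_le_pow_left hnX.2 3
    have hx3 : 1 ≤ X ^ 3 := Nat.one_le_pow _ _ hX
    have e1 : (2 * X) ^ 3 = 8 * X ^ 3 := by ring
    rw [e1] at h2; generalize X ^ 3 = Y at h2 hx3 ⊢; omega
  obtain ⟨d, hd, hd3, hΩ, hp⟩ :=
    exists_dvd_of_le_card_largePrimeFactors' (m := n ^ 3 + 2) (by positivity) hz1 hh3 hn.2
  refine ⟨d, ?_, hd⟩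
  rw [hD, mem_filter, mem_Icc]
  refine ⟨⟨Nat.pos_of_ne_zero (fun h0 => by simp [h0] at hd), ?_⟩, hΩ, fun p hpd => ?_⟩
  · -- `d ≤ 3X` from `d³ ≤ n³ + 2 ≤ 10X³ < 27X³`
    have h3 : d ^ 3 < (3 * X) ^ 3 := by
      refine lt_of_le_of_lt (hd3.trans hm10) ?_
      have hx3 : 1 ≤ X ^ 3 := Nat.one_le_pow _ _ hX
      have e2 : (3 * X) ^ 3 = 27 * X ^ 3 := by ring
      rw [e2]; generalize X ^ 3 = Y at hx3 ⊢; omega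
    exact (lt_of_pow_lt_pow_left₀ 3 (by positivity) h3).le
  · have hpp := Nat.prime_of_mem_primeFactors hpd
    obtain ⟨hzp, hbound⟩ := hp p hpp (Nat.dvd_of_mem_primeFactors hpd)
    exact ⟨hzp, hbound.trans hm10⟩

end Irving2015
end Literature.NumberTheory.Sieve
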